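import Summits.KontsevichZagierPeriods.KontsevichZagierPeriods.Theorems.LinRedNormalFormArrangementNormalFormStubRebaseSimpleZeroNestedDiffE1Cell
import Summits.KontsevichZagierPeriods.KontsevichZagierPeriods.Theorems.LinRedNormalFormArrangementNormalFormStubRebaseSimpleZeroNestedDiffWedge

/-!
# Stub `stub_rebaseSimpleZeroTwo`, part `rebaseSimpleZero_HDiff1_of_HPar1` (crux
`ArrangementNormalForm`, line `janus-bands`) — brick `NestedDiffE1VertexTools`

Tools for the box-Janus dissections of a datum of the interval normal form `HDiff₁`
(`RebaseE1.IsDN`) at a PINCH VERTEX `(l, t₀)` (`A(l) = B(l) = t₀`) through which ONE letter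
passes. The boxes of the sub- and super-section Janus then touch the letter plane along the vertex
line, and their absolute convergence is the WEDGE ESTIMATE `RebaseDiff.integrableOn_wedge` in a
suitable linear frame:
* `RebaseE1.wLinY k k' μ : z ↦ (t_{k'}, t_k − μ y, y)` (a fibre form against the base) and
  `RebaseE1.wLinT k k' μ : z ↦ (y, t_k − μ y, t_{k'} − μ y)` (two parallel fibre forms), both of
  non-zero determinant;
* `RebaseE1.integrableOn_of_wedge` — the wedge estimate on a bounded semialgebraic set;
* `RebaseE1.key_bound` — `|K|/(|Y| |P| |Q|) ≤ (|K|/(ρ g √c))/(√|P| √M)` when `|Y| ≥ ρ`,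
  `|Q| ≥ g` and `|P| ≥ c M`: the singular factor `1/|P|` is traded for two square roots;
* `RebaseE1.IsDN.slope_lt`, `RebaseE1.ev_pinch` — at a pinch the bounds are
  `t₀ + α (y − l) < t₀ + β (y − l)` with `α < β`; `RebaseE1.small_arith` — mesh bookkeeping.
Registered: `rebaseSimpleZero_E1wedgeFrames`.

References: M. Kontsevich, D. Zagier, *Periods* (2001), §1.2.
-/

noncomputable section

open Set MeasureTheory MvPolynomial
open Literature.NumberTheory.Transcendental Literature.ModelTheory.ExponentialFields

namespace Summit.KontsevichZagierPeriods.ArrangementNormalForm.JanusBands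

namespace RebaseE1

open SeparatePos RebasePos RebaseZero RebaseNest RebaseDiff

variable {i j : Fin 2} {s : KZ.IntegralRep (0 + 1 + 2)} {l u : ℚ} {A B : Cf} {T : BData}
  {p : MvPolynomial (Fin 0) ℚ} {a : Fin 2 → Option Cf} {ci cj : Cf}

/-! ### The size of the literal integrand -/

/-- The absolute value of the literal integrand of a doubly lettered pair. -/
theorem abs_glitB (hL : LData T a i j ci cj) (p : MvPolynomial (Fin 0) ℚ) (z : Fin (0 + 1 + 2) → ℝ) :
    |glitB T p a z| = |Kc T p| * (1 / |yv z - T.ℓ₂.2|) *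
      ((1 / |tv z i - ev ci (yv z)|) * (1 / |tv z j - ev cj (yv z)|)) := by
  rw [glitB_two T p a hL.ne ci cj hL.hi hL.hj hL.n1 hL.n2, abs_mul, abs_mul, abs_mul, abs_div, abs_div,
    abs_div, abs_one]

/-- **Trading a singular factor for two square roots**: if `|Y| ≥ ρ`, `|Q| ≥ g` and `|P| ≥ c M`
(`ρ, g, c, M > 0`) then `|K| |Y|⁻¹ |P|⁻¹ |Q|⁻¹ ≤ (|K|/(ρ g √c))/(√|P| √M)`. [folklore] -/
theorem key_bound {K Y P Q ρ g c M : ℝ} (hρ : 0 < ρ) (hg : 0 < g) (hc : 0 < c) (hM : 0 < M)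
    (hY : ρ ≤ |Y|) (hQ : g ≤ |Q|) (hP : c * M ≤ |P|) :
    |K| * (1 / |Y|) * ((1 / |P|) * (1 / |Q|)) ≤
      (|K| / (ρ * g * Real.sqrt c)) / (Real.sqrt |P| * Real.sqrt M) := by
  have hcM : 0 < c * M := mul_pos hc hM
  have hP0 : 0 < |P| := hcM.trans_le hP
  have e1 : 1 / |Y| ≤ 1 / ρ := one_div_le_one_div_of_le hρ hY
  have e2 : 1 / |Q| ≤ 1 / g := one_div_le_one_div_of_le hg hQ
  have hs : Real.sqrt (c * M) ≤ Real.sqrt |P| := Real.sqrt_le_sqrt hP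
  have hsc : 0 < Real.sqrt c := Real.sqrt_pos.2 hc
  have hsM : 0 < Real.sqrt M := Real.sqrt_pos.2 hM
  have hsP : 0 < Real.sqrt |P| := Real.sqrt_pos.2 hP0
  have e3 : 1 / |P| ≤ 1 / (Real.sqrt |P| * (Real.sqrt c * Real.sqrt M)) := by
    rw [← Real.sqrt_mul hc.le M]
    have h1 : Real.sqrt |P| * Real.sqrt (c * M) ≤ Real.sqrt |P| * Real.sqrt |P| :=
      mul_le_mul_of_nonneg_left hs (Real.sqrt_nonneg _)
    rw [Real.mul_self_sqrt (abs_nonneg P)] at h1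
    exact one_div_le_one_div_of_le (by positivity) h1
  calc |K| * (1 / |Y|) * ((1 / |P|) * (1 / |Q|))
      ≤ |K| * (1 / ρ) * ((1 / (Real.sqrt |P| * (Real.sqrt c * Real.sqrt M))) * (1 / g)) :=
        mul_le_mul (mul_le_mul_of_nonneg_left e1 (abs_nonneg K))
          (mul_le_mul e3 e2 (by positivity) (by positivity)) (by positivity) (by positivity)
    _ = (|K| / (ρ * g * Real.sqrt c)) / (Real.sqrt |P| * Real.sqrt M) := by
        field_simp

/-! ### The two linear frames -/

/-- The frame `z ↦ (t_{k'}, t_k − μ y, y)`: a fibre form against the base. -/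
def wLinY (k k' : Fin 2) (μ : ℝ) : (Fin 3 → ℝ) →ₗ[ℝ] (Fin 3 → ℝ) where
  toFun z := ![tv (k := 2) z k', tv (k := 2) z k - μ * yv (k := 2) z, yv (k := 2) z]
  map_add' z w := by
    funext q
    fin_cases q <;> first | (simp [yv, tv]; ring) | simp [yv, tv]
  map_smul' c z := by
    funext q
    fin_cases q <;> first | (simp [yv, tv]; ring) | simp [yv, tv]

/-- `wLinY` in coordinates. -/
theorem wLinY_apply (k k' : Fin 2) (μ : ℝ) (z : Fin 3 → ℝ) :
    wLinY k k' μ z 0 = tv (k := 2) z k' ∧ wLinY k k' μ z 1 = tv (k := 2) z k - μ * yv (k := 2) z ∧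
      wLinY k k' μ z 2 = yv (k := 2) z :=
  ⟨rfl, rfl, rfl⟩

/-- A left inverse of `wLinY`. -/
def wBackY (k k' : Fin 2) (μ : ℝ) (w : Fin 3 → ℝ) : Fin 3 → ℝ := fun q =>
  if q = tIdx (k := 2) k' then w 0 else if q = tIdx (k := 2) k then w 1 + μ * w 2 else w 2

/-- `wBackY ∘ wLinY = id`. -/
theorem wBackY_wLinY {k k' : Fin 2} (hk : k ≠ k') (μ : ℝ) (z : Fin 3 → ℝ) :
    wBackY k k' μ (wLinY k k' μ z) = z := by
  obtain ⟨e0, e1, e2⟩ := wLinY_apply k k' μ z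
  funext q
  rcases idx_cases (k := 2) q with rfl | ⟨r, rfl⟩
  · simp only [wBackY, if_neg (yIdx_ne_tIdx k'), if_neg (yIdx_ne_tIdx k)]
    exact e2
  · rcases fin_two_eq_or hk r with rfl | rfl
    · simp only [wBackY, if_neg (tIdx_injective.ne hk), if_true, e1, e2, tv, yv]
      ring
    · simp only [wBackY, if_true, e0, tv]

/-- `wLinY` has non-zero determinant. -/
theorem wLinY_det_ne {k k' : Fin 2} (hk : k ≠ k') (μ : ℝ) : LinearMap.det (wLinY k k' μ) ≠ 0 := by
  have hinj : Function.Injective (wLinY k k' μ) :=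
    Function.LeftInverse.injective (g := wBackY k k' μ) (wBackY_wLinY hk μ)
  have hu : IsUnit (wLinY k k' μ) :=
    (LinearMap.isUnit_iff_ker_eq_bot _).2 (LinearMap.ker_eq_bot.2 hinj)
  exact ((LinearMap.isUnit_iff_isUnit_det _).1 hu).ne_zero

/-- The frame `z ↦ (y, t_k − μ y, t_{k'} − μ y)`: two parallel fibre forms. -/
def wLinT (k k' : Fin 2) (μ : ℝ) : (Fin 3 → ℝ) →ₗ[ℝ] (Fin 3 → ℝ) where
  toFun z := ![yv (k := 2) z, tv (k := 2) z k - μ * yv (k := 2) z, tv (k := 2) z k' - μ * yv (k := 2) z]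
  map_add' z w := by
    funext q
    fin_cases q <;> first | (simp [yv, tv]; ring) | simp [yv, tv]
  map_smul' c z := by
    funext q
    fin_cases q <;> first | (simp [yv, tv]; ring) | simp [yv, tv]

/-- `wLinT` in coordinates. -/
theorem wLinT_apply (k k' : Fin 2) (μ : ℝ) (z : Fin 3 → ℝ) :
    wLinT k k' μ z 0 = yv (k := 2) z ∧ wLinT k k' μ z 1 = tv (k := 2) z k - μ * yv (k := 2) z ∧
      wLinT k k' μ z 2 = tv (k := 2) z k' - μ * yv (k := 2) z :=
  ⟨rfl, rfl, rfl⟩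

/-- A left inverse of `wLinT`. -/
def wBackT (k k' : Fin 2) (μ : ℝ) (w : Fin 3 → ℝ) : Fin 3 → ℝ := fun q =>
  if q = tIdx (k := 2) k then w 1 + μ * w 0 else if q = tIdx (k := 2) k' then w 2 + μ * w 0 else w 0

/-- `wBackT ∘ wLinT = id`. -/
theorem wBackT_wLinT {k k' : Fin 2} (hk : k ≠ k') (μ : ℝ) (z : Fin 3 → ℝ) :
    wBackT k k' μ (wLinT k k' μ z) = z := by
  obtain ⟨e0, e1, e2⟩ := wLinT_apply k k' μ z
  funext q
  rcases idx_cases (k := 2) q with rfl | ⟨r, rfl⟩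
  · simp only [wBackT, if_neg (yIdx_ne_tIdx k'), if_neg (yIdx_ne_tIdx k)]
    exact e0
  · rcases fin_two_eq_or hk r with rfl | rfl
    · simp only [wBackT, if_true, e1, e0, tv, yv]
      ring
    · simp only [wBackT, if_neg (tIdx_injective.ne hk.symm), if_true, e2, e0, tv, yv]
      ring

/-- `wLinT` has non-zero determinant. -/
theorem wLinT_det_ne {k k' : Fin 2} (hk : k ≠ k') (μ : ℝ) : LinearMap.det (wLinT k k' μ) ≠ 0 := by
  have hinj : Function.Injective (wLinT k k' μ) :=
    Function.LeftInverse.injective (g := wBackT k k' μ) (wBackT_wLinT hk μ)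
  have hu : IsUnit (wLinT k k' μ) :=
    (LinearMap.isUnit_iff_ker_eq_bot _).2 (LinearMap.ker_eq_bot.2 hinj)
  exact ((LinearMap.isUnit_iff_isUnit_det _).1 hu).ne_zero

/-! ### The wedge estimate on a bounded semialgebraic set -/

/-- **The wedge estimate on a bounded semialgebraic set**: a semialgebraic function bounded by
`K/(√|f z 1 − a₀| √|f z 2 − b₀|)` in an invertible linear frame `f` is absolutely integrable.
[folklore] -/
theorem integrableOn_of_wedge {D : Set (Fin (0 + 1 + 2) → ℝ)} (hD : IsSemialgebraic ℚ D)
    (hbd : Bornology.IsBounded D) {φ : (Fin (0 + 1 + 2) → ℝ) → ℝ} (hφ : IsSemialgebraicFunOn ℚ D φ)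
    (f : (Fin 3 → ℝ) →ₗ[ℝ] (Fin 3 → ℝ)) (hf : LinearMap.det f ≠ 0) (a₀ b₀ K : ℝ)
    (hK : ∀ z ∈ D, f z 1 ≠ a₀ → f z 2 ≠ b₀ → |φ z| ≤ K / (Real.sqrt |f z 1 - a₀| * Real.sqrt |f z 2 - b₀|)) :
    IntegrableOn φ D := by
  have hDm : MeasurableSet D := IsSemialgebraic.measurableSet_holds hD
  obtain ⟨Rb, hRb⟩ := hbd.exists_norm_le
  set C : ℝ := ‖LinearMap.toContinuousLinearMap f‖ with hC
  refine integrableOn_wedge hDm (KZ.aestronglyMeasurable_of_isSemialgebraicFunOn hφ hDm) f hf a₀ b₀ K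
    (C * Rb + |a₀| + |b₀|) (fun z hz => ?_) hK
  have hz1 : ‖f z‖ ≤ C * ‖z‖ := by
    have h := (LinearMap.toContinuousLinearMap f).le_opNorm z
    rwa [LinearMap.coe_toContinuousLinearMap'] at h
  have hz2 : ‖f z‖ ≤ C * Rb := hz1.trans (mul_le_mul_of_nonneg_left (hRb z hz) (norm_nonneg _))
  have hk : ∀ k, |f z k| ≤ C * Rb := fun k => by
    have h := norm_le_pi_norm (f z) k
    rw [Real.norm_eq_abs] at h
    exact h.trans hz2
  refine ⟨by linarith [hk 0, abs_nonneg a₀, abs_nonneg b₀], ?_, ?_⟩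
  · calc |f z 1 - a₀| ≤ |f z 1| + |a₀| := abs_sub _ _
      _ ≤ C * Rb + |a₀| + |b₀| := by linarith [hk 1, abs_nonneg b₀]
  · calc |f z 2 - b₀| ≤ |f z 2| + |b₀| := abs_sub _ _
      _ ≤ C * Rb + |a₀| + |b₀| := by linarith [hk 2, abs_nonneg a₀]

/-! ### Slopes at a pinch -/

/-- An affine function read from its value at `l`. -/
theorem ev_pinch (c : Cf) (l : ℚ) (y : ℝ) : ev c y = evq c l + (c.1 (Fin.last 0) : ℝ) * (y - l) := by
  rw [ev, evq]; push_cast; ring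

/-- At a pinch `A(l) = B(l)` of a datum of `HDiff₁` the slopes satisfy `A' < B'`. -/
theorem IsDN.slope_lt (h : IsDN s l u A B T p a i j) (hpinch : evq A l = evq B l) :
    A.1 (Fin.last 0) < B.1 (Fin.last 0) := by
  have hlu : (l : ℝ) < u := by exact_mod_cast h.lu
  have h1 := h.AB (((l : ℝ) + u) / 2) (by linarith) (by linarith)
  rw [ev_pinch A l, ev_pinch B l, hpinch] at h1
  have hpos : (0 : ℝ) < ((l : ℝ) + u) / 2 - l := by linarith
  have h2 : (A.1 (Fin.last 0) : ℝ) * (((l : ℝ) + u) / 2 - l) < B.1 (Fin.last 0) * (((l : ℝ) + u) / 2 - l) := by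
    linarith
  have h3 := lt_of_mul_lt_mul_right h2 hpos.le
  exact_mod_cast h3

/-- The increment of an affine function near `l`: `|c(y) − c(l)| ≤ |c'| δ` for `|y − l| ≤ δ`. -/
theorem abs_ev_sub_evq_le (c : Cf) (l : ℚ) {y δ : ℝ} (hy : |y - l| ≤ δ) :
    |ev c y - evq c l| ≤ |(c.1 (Fin.last 0) : ℝ)| * δ := by
  rw [ev_pinch c l, add_sub_cancel_left, abs_mul]
  exact mul_le_mul_of_nonneg_left hy (abs_nonneg _)

/-- Mesh bookkeeping: `S δ ≤ m/8` with `S = |α| + |β| + |λ| + 1` bounds each slope increment by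
`m/8`. [folklore] -/
theorem small_arith {α β lam m δ : ℚ} (hδ0 : 0 ≤ δ) (hSδ : (|α| + |β| + |lam| + 1) * δ ≤ m / 8) :
    |α| * δ ≤ m / 8 ∧ |β| * δ ≤ m / 8 ∧ |lam| * δ ≤ m / 8 := by
  have e : (|α| + |β| + |lam| + 1) * δ = |α| * δ + |β| * δ + |lam| * δ + δ := by ring
  rw [e] at hSδ
  have h1 : 0 ≤ |α| * δ := by positivity
  have h2 : 0 ≤ |β| * δ := by positivity
  have h3 : 0 ≤ |lam| * δ := by positivity
  exact ⟨by linarith, by linarith, by linarith⟩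

/-- **The explicit mesh at a vertex.** For a scale `m > 0` there is a rational `δ > 0` with
`l + δ < u` and `(|α| + |β| + |λ| + 1) δ ≤ m/8`. [folklore] -/
theorem exists_mesh (hlu : l < u) (α β lam : ℚ) {m : ℚ} (hm : 0 < m) :
    ∃ δ : ℚ, 0 < δ ∧ l + δ < u ∧ |α| * δ ≤ m / 8 ∧ |β| * δ ≤ m / 8 ∧ |lam| * δ ≤ m / 8 := by
  set S : ℚ := |α| + |β| + |lam| + 1 with hS
  have hS0 : 0 < S := by positivity
  set δ : ℚ := min ((u - l) / 2) (m / 8 / S) with hδ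
  have hδ0 : 0 < δ := lt_min (by linarith) (by positivity)
  have hqu : l + δ < u := by
    have := min_le_left ((u - l) / 2) (m / 8 / S); rw [← hδ] at this; linarith
  have hSδ : S * δ ≤ m / 8 := by
    have := min_le_right ((u - l) / 2) (m / 8 / S); rw [← hδ] at this
    calc S * δ ≤ S * (m / 8 / S) := mul_le_mul_of_nonneg_left this hS0.le
      _ = m / 8 := by field_simp
  exact ⟨δ, hδ0, hqu, small_arith hδ0.le hSδ⟩

/-- The distance of the open interval `(l, u₁)`, `u₁ ≤ u`, from a base pole off `[l, u]`. -/
theorem pole_margin (hr : T.ℓ₂.2 < l ∨ u < T.ℓ₂.2) {u₁ : ℚ} (hu₁ : u₁ ≤ u) :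
    ∃ ρ : ℝ, 0 < ρ ∧ ∀ y : ℝ, (l : ℝ) < y → y < u₁ → ρ ≤ |y - T.ℓ₂.2| := by
  rcases hr with hr | hr
  · have hr' : (T.ℓ₂.2 : ℝ) < l := by exact_mod_cast hr
    refine ⟨l - T.ℓ₂.2, by linarith, fun y h1 _ => ?_⟩
    rw [abs_of_pos (by linarith)]; linarith
  · have hr' : (u : ℝ) < T.ℓ₂.2 := by exact_mod_cast hr
    have hu' : (u₁ : ℝ) ≤ u := by exact_mod_cast hu₁
    refine ⟨T.ℓ₂.2 - u, by linarith, fun y _ h2 => ?_⟩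
    rw [abs_of_neg (by linarith)]; linarith

end RebaseE1

/-- **Registered brick `rebaseSimpleZero_E1wedgeFrames`** (part `rebaseSimpleZero_HDiff1_of_HPar1` of
`stub_rebaseSimpleZeroTwo`, line `janus-bands`): the two linear frames of the vertex wedge
estimates, `z ↦ (t_{k'}, t_k − μ y, y)` and `z ↦ (y, t_k − μ y, t_{k'} − μ y)`, are invertible
(`RebaseE1.wLinY_det_ne`, `RebaseE1.wLinT_det_ne`). [folklore] -/
theorem rebaseSimpleZero_E1wedgeFrames (k k' : Fin 2) (hk : k ≠ k') (μ : ℝ) : LinearMap.det (RebaseE1.wLinY k k' μ) ≠ 0 ∧ LinearMap.det (RebaseE1.wLinT k k' μ) ≠ 0 :=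
  ⟨RebaseE1.wLinY_det_ne hk μ, RebaseE1.wLinT_det_ne hk μ⟩

end Summit.KontsevichZagierPeriods.ArrangementNormalForm.JanusBands
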